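import Literature.NumberTheory.EllipticCurves.PAdicLFunctionMinusMult
import HarnessLib

/-!
# The PLUS Mazur–Tate–Teitelbaum measure at a prime `p ∣ N` (`ε(p) = 0`: ONE term) and its
# `ω^i`-branches `L⁺_p(f, α, ω^i, T)` — the even branches of `L_p(E)` at a prime of MULTIPLICATIVE reduction

Topic `NumberTheory/EllipticCurves`; namespace `Literature.NumberTheory.EllipticCurves`. DEFINITIONS
only (plus two unfolding `simp` lemmas and the value on `ℤ_p`); nothing asserted, no named fact
(D-0026). Plus-side twin of `PAdicLFunctionMinusMult` (`msdMinusMeasureMult f α`, the one-term MINUS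
measure at `p ∣ N`, and its odd branches `padicLFunctionMinusBranchMult f α i`) and companion of
`PAdicLFunctionMultiplicativeInterpolation` (`IsMultPAdicLFunctionOf f p α L`, the interpolation
PACKAGE of the trivial branch `ω⁰` at `p ∣ N`, which does not name the non-trivial even branches).

**The point.** Mazur–Tate–Teitelbaum 1986, Ch. I §10, (10.1): for an eigenform `f` of level `N`,
character `ε`, and an allowable `p`-root `α`, the `p`-adic distribution is
`μ_{f,α}(a + pⁿℤ_p) = α⁻ⁿ [a/pⁿ] − ε(p) α⁻⁽ⁿ⁺¹⁾ [a/pⁿ⁻¹]`, with `ε(p) = 0` when `p ∣ N`: at a prime of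
MULTIPLICATIVE reduction of an elliptic curve (`α = a_p = ±1` the only allowable root) the measure has
ONE term, `μ⁺_{f,α}(a + pⁿℤ_p) = α⁻ⁿ [a/pⁿ]⁺_f`, whose distribution property is the `U_p`-relation
`a_p [r]⁺ = ∑_{j mod p} [(r + j)/p]⁺` (MTT §I.4 (4.2) with `ε(p) = 0`; tree THEOREM
`intCast_mul_ratPlusSymbol_of_dvd`). This file supplies, symbol for symbol as in
`PAdicLFunctionMinusMult`:

* `msdPlusMeasureMult f α n a = α⁻ⁿ [a/pⁿ]⁺_f` (`[·]⁺ = ratPlusSymbol f`, cast `ℚ → ℚ_p`);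
  `msdPlusMeasureMult_zero`: `μ⁺(ℤ_p) = [0]⁺_f`.
* `padicLPlusBranchMultRiemannSum / padicLPlusBranchMultCoeff / padicLFunctionPlusBranchMult f α i`
  — the `ω^i`-branches `∫_{ℤ_p^×} ω^i(x) (1+T)^{ℓ(x)} dμ⁺_{f,α}(x) ∈ ℚ_p⟦T⟧` of this measure (Riemann
  sums over `ζ γˢ + p^{n+e₀}ℤ_p`, `ζ` Teichmüller, `γ = cyclotomicGenerator p`, limit, power series),
  literally `padicLBranchRiemannSum / …Coeff / padicLFunctionBranch` with `μ⁺_mult` for `μ`.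
  For EVEN `i` and `α = a_p = ±1` these are the even tame branches `L_p(E, ω^i, T)` of the `p`-adic
  `L`-function of an elliptic curve `E` with multiplicative reduction at `p` (MTT §I.13; normalised by
  `Ω⁺_f`); the branch `i = 0` is the function carried by the package `IsMultPAdicLFunctionOf` (its
  constant term `(1 − α⁻¹)[0]⁺_f` = `∑_{a ∈ (ℤ/p)ˣ} α⁻¹[a/p]⁺` by the `U_p`-relation), and for
  `p ≥ 5` the `ω^i`, `i ∉ {0, (p−1)/2}` even, are the `e_i`-components of Wuthrich's
  `L_p(E) ∈ ℤ_p⟦ℤ_p^×⟧` (Doc. Math. 19 (2014), Cor. 18) needed by the cell's line V19b.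

NOT here (theorems, sibling file `PAdicLFunctionPlusMultDistributionProofs`): the distribution law
of `μ⁺_mult` and the constant terms `L⁺_p(f, a_p, ω^i, 0) = ∑_{a ∈ (ℤ/p^{e₀})ˣ} μ⁺(a) ω(a)^i
= a_p⁻¹ ∑_{a mod p} ω(a)^i [a/p]⁺_f`.

Motivation (BSD rank-`≤ 1` residual cell `b2b-bsdres`, HOME `run/shared/lean/b2b/bsd-rank1-residual/`,
sub-cell additive-p4, designed line V19b = the (M)-rows of X3/X4 at `p ≥ 5`: `W ≅ V^{(p*)}` additive at
`p` with `V` multiplicative at `p`, 33 CORE-open rank-(0,0) pairs `N < 2·10⁴`): the all-branches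
readings of Wuthrich's Thm. 16 / Thm. 3 for `V` over `ℚ(ζ_{p^∞}) = ℚ(ζ_p)_∞` involve ALL `p − 1` tame
branches of `L_p(V)`; the even non-trivial ones at a multiplicative prime had no name in the tree.
HONEST FRAMING: vocabulary only; no label changes.

## References
* B. Mazur, J. Tate, J. Teitelbaum, *On `p`-adic analogues of the conjectures of Birch and
  Swinnerton-Dyer*, Invent. Math. 84 (1986) 1–48: Ch. I §4 (4.2), §8, §10 (10.1) (`ε(p) = 0` for
  `p ∣ N`), §13 (branches), §14. [MazurTateTeitelbaum1986Invent]
* C. Wuthrich, Doc. Math. 19 (2014) 381–402, Cor. 18. [Wuthrich2014]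
-/

noncomputable section

open scoped MatrixGroups ModularForm

open CongruenceSubgroup Filter Topology Literature.NumberTheory.EllipticCurves.ModularForms

namespace Literature.NumberTheory.EllipticCurves

section Measure

variable {N : ℕ} (f : CuspForm (Gamma0 N) 2) {p : ℕ} [Fact p.Prime]

/-- The **plus Mazur–Tate–Teitelbaum measure at a prime `p ∣ N`** (`ε(p) = 0`, ONE term):
`μ⁺_{f,α}(a + pⁿℤ_p) = α⁻ⁿ [a/pⁿ]⁺_f` on the compact opens `a + pⁿℤ_p` (`a : ZMod (p ^ n)`,
represented by `a.val`; any representative gives the same value by `ratPlusSymbol_add_intCast_eq`),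
with the plus symbol `[·]⁺ = ratPlusSymbol f` cast `ℚ → ℚ_p` — formula (10.1) of
Mazur–Tate–Teitelbaum 1986 §I.10 in the case `ε(p) = 0`, for the allowable root `α` (`= a_p(f)` for
the newform of an elliptic curve with multiplicative reduction at `p`). One-term twin of `msdMeasure`
(the case `ε(p) = 1`, `p ∤ N`) and plus twin of `msdMinusMeasureMult`. Junk (harmless) for `α = 0`.
[cite: MazurTateTeitelbaum1986Invent, §I.10 (10.1) with ε(p) = 0] -/
def msdPlusMeasureMult (α : ℚ_[p]) (n : ℕ) (a : ZMod (p ^ n)) : ℚ_[p] :=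
  α⁻¹ ^ n * (ratPlusSymbol f ((a.val : ℚ) / (p : ℚ) ^ n) : ℚ_[p])

/-- `μ⁺_{f,α}(ℤ_p) = [0]⁺_f` for the one-term plus measure (level `n = 0`: `ZMod (p⁰)` is a
singleton, the representative is `0`). [cite: MazurTateTeitelbaum1986Invent, §I.10 (10.1) with ε(p) = 0] -/
theorem msdPlusMeasureMult_zero (α : ℚ_[p]) (a : ZMod (p ^ 0)) :
    msdPlusMeasureMult f α 0 a = (ratPlusSymbol f 0 : ℚ_[p]) := by
  haveI : Subsingleton (ZMod (p ^ 0)) := (ZMod.subsingleton_iff).mpr (pow_zero p)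
  rw [Subsingleton.elim a 0]
  simp [msdPlusMeasureMult]

/-- The `n`-th **Riemann sum** for the `k`-th coefficient of the `ω^i`-branch of the one-term plus
measure at `p ∣ N`: `∑_ζ ζ^i ∑_{s mod pⁿ} μ⁺_{f,α}(ζ γˢ + p^{n+e₀}ℤ_p) · (s choose k)` (`ζ` over the
Teichmüller representatives = torsion of `ℤ_p^×`, `γ = cyclotomicGenerator p`, `e₀ = cyclotomicExponent p`)
— literally `padicLBranchRiemannSum` with `msdPlusMeasureMult` for `msdMeasure`.
[cite: MazurTateTeitelbaum1986Invent, §I.13] -/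
def padicLPlusBranchMultRiemannSum (α : ℚ_[p]) (i k n : ℕ) : ℚ_[p] :=
  ∑ᶠ ζ : rootsOfUnity (torsionOrder p) ℤ_[p], ∑ s : ZMod (p ^ n),
    ((((ζ : ℤ_[p]ˣ) : ℤ_[p]) : ℚ_[p]) ^ i *
      msdPlusMeasureMult f α (n + cyclotomicExponent p)
          (PadicInt.toZModPow (n + cyclotomicExponent p) ((ζ : ℤ_[p]ˣ) : ℤ_[p]) *
            (cyclotomicGenerator p : ZMod (p ^ (n + cyclotomicExponent p))) ^ s.val) *
        (s.val.choose k : ℚ_[p]))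

/-- The `k`-th **coefficient of the `ω^i`-branch** of the one-term plus measure at `p ∣ N`:
`∫_{ℤ_p^×} ω^i(x) (ℓ(x) choose k) dμ⁺_{f,α}(x) = lim_n padicLPlusBranchMultRiemannSum f α i k n`
(junk value of `limUnder` if the limit does not exist, as for `padicLBranchCoeff`).
[cite: MazurTateTeitelbaum1986Invent, §I.11–I.13] -/
def padicLPlusBranchMultCoeff (α : ℚ_[p]) (i k : ℕ) : ℚ_[p] :=
  limUnder atTop (padicLPlusBranchMultRiemannSum f α i k)

/-- The **`ω^i`-branch of the `p`-adic `L`-function at a prime `p ∣ N`, built on the one-term PLUS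
measure**: `L⁺_p(f, α, ω^i, T) = ∫_{ℤ_p^×} ω^i(x) (1 + T)^{ℓ(x)} dμ⁺_{f,α}(x) ∈ ℚ_p⟦T⟧`. For EVEN `i`
and `α = a_p(f) = ±1` (the newform of an elliptic curve `E/ℚ` with multiplicative reduction at `p`)
this is the even tame branch `L_p(E, ω^i, T)` of Mazur–Tate–Teitelbaum §I.13 normalised by `Ω⁺_f`
(special values `τ(ω^iκ) L(f, ω^{−i}κ̄, 1)/Ω⁺_f` up to the usual factors, §I.14 with `ε(p) = 0`).
Twin of `padicLFunctionBranch` (`p ∤ N`) and of `padicLFunctionMinusBranchMult` (odd side).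
[cite: MazurTateTeitelbaum1986Invent, §I.13] -/
def padicLFunctionPlusBranchMult (α : ℚ_[p]) (i : ℕ) : PowerSeries ℚ_[p] :=
  PowerSeries.mk (padicLPlusBranchMultCoeff f α i)

/-- The `k`-th coefficient of `L⁺_p(f, α, ω^i, T)` at `p ∣ N` is `padicLPlusBranchMultCoeff f α i k`
(unfolding; MTT §I.13). [cite: MazurTateTeitelbaum1986Invent, §I.13] -/
@[simp] theorem coeff_padicLFunctionPlusBranchMult (α : ℚ_[p]) (i k : ℕ) :
    PowerSeries.coeff k (padicLFunctionPlusBranchMult f α i) = padicLPlusBranchMultCoeff f α i k :=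
  PowerSeries.coeff_mk _ _

/-- The constant term of `L⁺_p(f, α, ω^i, T)` at `p ∣ N` is `padicLPlusBranchMultCoeff f α i 0 =
∫ ω^i dμ⁺_{f,α}` (unfolding; MTT §I.13). [cite: MazurTateTeitelbaum1986Invent, §I.13] -/
@[simp] theorem constantCoeff_padicLFunctionPlusBranchMult (α : ℚ_[p]) (i : ℕ) :
    PowerSeries.constantCoeff (padicLFunctionPlusBranchMult f α i) =
      padicLPlusBranchMultCoeff f α i 0 :=
  PowerSeries.constantCoeff_mk

end Measure

end Literature.NumberTheory.EllipticCurves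

end
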